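import Literature.NumberTheory.Automorphic.AsaiSignCont
import Literature.NumberTheory.Automorphic.AsaiAtOneRankOne
import Literature.NumberTheory.Automorphic.AsaiSignContProofs
import Literature.NumberTheory.Automorphic.ClassFieldCharacterFrobenius
import Literature.NumberTheory.Automorphic.ExistsClassFieldCharacterHolds
import Literature.NumberTheory.GaloisRepresentations.HeckeCharacterWeakApproximation
import HarnessLib

/-!
# Mok's Asai-pole dichotomy in continuation form, rank one: the `GL(1)` stratum of
# `Mok2014_partialAsaiL_continuation_pole_dichotomy`, proved

Topic `NumberTheory/Automorphic`; namespace `Literature.NumberTheory.Automorphic` (Hecke-character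
lemmas in `Literature.NumberTheory.GaloisRepresentations.HeckeCharacter`, for dot notation). Proof
file (theorems only: no definition, no named fact, no instance; provefact unit
`Mok2014_partialAsaiL_continuation_pole_dichotomy`, 2026-08-16), sibling of `AsaiSignCont` (the named
fact: Mok, *Endoscopic classification …*, Mem. AMS 1108, §2.5 and Thm. 2.5.4 (a) = Grbac–Shahidi,
Pacific J. Math. 276 (2015), Thm. 4.3 (2), rendered for the continued partial Asai `L`-functions of
a conjugate self-dual cuspidal `Π` on `GL_N(𝔸_E)` on the half-plane `{1/2 < Re s}`), of
`AsaiSignContProofs` / `AsaiSignContProofsL2` (its reduction, in every rank, to Grbac–Shahidi's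
holomorphy theorem and the Rankin–Selberg facts) and of `AsaiAtOneRankOne` (the rank-one stratum of
the `s = 1` fact `GrbacShahidi2015_partialAsaiL_at_one`, whose dictionary this file reuses).

## What is proved

* `Mok2014_partialAsaiL_continuation_pole_dichotomy_rank_one` (**main**) — the named fact **for
  `N = 1`**, verbatim: for every quadratic `E/F`, `c ≠ 1`, every cuspidal datum `π` of `GL₁(𝔸_E)`
  conjugate self-dual almost everywhere (`IsConjSelfDualAE`), there is a sign `η` such that for
  every Asai datum `(S, A)` (with `σ₀ = 1`) both partial Asai Euler products are multipliable on
  `{1 < Re s}`, `(s - 1) L^S(s, π, As^η)` continues holomorphically to `{1/2 < Re s}` with non-zero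
  value at `1`, and `L^S(s, π, As^{-η})` continues holomorphically to `{1/2 < Re s}`, non-zero at `1`.
  No hypothesis beyond those of the fact; axioms `propext`, `Classical.choice`, `Quot.sound`.
* `Mok2014_partialAsaiL_continuation_pole_dichotomy_of_two_le` — consequently the named fact is
  implied by (equivalent to) its own restriction to ranks `N ≥ 2`.
* `hol_half_plane_rank_one`, `rankinSelberg_pair_rank_one`,
  `eval_asaiLocalPolynomial_at_one_ne_zero_rank_one` — the hypotheses `hHol` (Grbac–Shahidi
  holomorphy), `hRS` (Jacquet–Shalika for `(Π, Π^c)`) of `AsaiSignContProofs` and `hNV` (no pole of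
  the unramified Asai factors at `s = 1`) of `AsaiSignContProofsL2` are THEOREMS in rank one;
  `Mok2014_partialAsaiL_continuation_pole_dichotomy_of_holomorphy_two_le` — the named fact follows from
  `hHol` and `hRS` restricted to ranks `N ≥ 2` (what remains of it is Grbac–Shahidi's Thm. 4.3 (2)(a)
  for `N ≥ 2` and the Rankin–Selberg pole of `L^{S_E}(s, Π × Π^c)`, `N ≥ 2`).

Reusable lemmas, all proved: `exists_entire_continuation_partialHeckeL` (Hecke: `(s-1)^k L^T(s, ψ)`
is ENTIRE, `k = [ψ = 1]`, value `≠ 0` at `1`), `HeckeCharacter.normTwist_eq_zero_of_conjSelfDual`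
(conjugate self-duality a.e. of `χ = χ₀‖·‖^{s₁}` forces `s₁ = 0` and `χ₀ (χ₀ ∘ c) = 1`),
`HeckeCharacter.isTrivialOnNormGroup_of_mul_galConj_eq_one`,
`HeckeCharacter.IsTrivialOnNormGroup.eq_one_or_eq_of_index_two` (a character of `𝕀_F/F^×N(𝕀_E)` is
`1` or the class-field character when the norm index is `2`),
`HeckeCharacter.IsClassFieldCharacter.valueAtUniformizer_eq_ite_smul` (`ω_{E/F}(ϖ_v) = -1` at inert,
`+1` at split places above an Asai datum), `exists_continuation_partialAsaiL_of_heckeCharacter`.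

## Proof (Grbac–Shahidi pp. 204–206 and Mok §2.5 in rank one)

In rank one the Langlands–Shahidi method is Hecke–Tate theory and "`σ` Galois self-dual" is the
class field theory of the quadratic extension `E/F`; every input below is a theorem of the tree.

1. *Dictionary* (`AsaiAtOneRankOne`): `π` acts through a Hecke character `χ = χ₀ ‖·‖^{s₁}` of `E`,
   `χ₀` trivial on `A_G` hence unitary; Satake parameters `{χ(ϖ_w)}`; `ψ₀ = χ₀|_{𝕀_F}`.
2. *Conjugate self-duality* (Mok §2.2: `Π^c ≅ Π^∨` a.e. on Satake parameters): `χ(ϖ_{c w}) = χ(ϖ_w)⁻¹`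
   a.e., so the Hecke character `χ₀ (χ₀ ∘ c) ‖·‖^{2 s₁}` is `1` at almost every uniformizer, hence
   trivial (rigidity, Cassels–Fröhlich VII Prop. 4.1); on `A_G` this reads `r^{2[E:ℚ]s₁} = 1`, so
   `s₁ = 0`, and then `χ₀ (χ₀ ∘ c) = 1`: `Π` is unitary and exactly conjugate self-dual.
3. *`ψ₀` is a character of `𝕀_F / F^× N_{E/F}(𝕀_E)`* (`N y = y · c y`), a group of order `2` (Tate's
   Main Theorem (B) for the cyclic `E/F`, `index_normGroup_eq_finrank_of_isCyclic`), so
   `ψ₀ ∈ {1, ω}` with `ω = ω_{E/F}` the class-field character (`exists_isClassFieldCharacter_holds`,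
   of order `2`). This is Grbac–Shahidi's case distinction "`σ` Galois self-dual", p. 204.
4. *Flicker's unramified computation in rank one* (pp. 305–306; `eval_asaiLocalPolynomial_rankOne`)
   and the decomposition law `ω(ϖ_v) = -1` / `+1` at inert / split `v ∉ S` (Artin reciprocity for
   `ω`, `IsClassFieldCharacter.isPrimitiveRoot_valueAtUniformizer`): the unramified factor of
   `L^S(s, π, As⁺)` at `v` is the Hecke factor of `ψ₀`, that of `L^S(s, π, As⁻)` the Hecke factor of
   `ψ₀ ω` — at EVERY `v ∉ S` (identity `(∗∗)` of p. 205 split into its two halves).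
5. *Hecke's theorem* (Iwasawa Thm. 3.1, Prop. 4.4; Tate Thm. 4.4.1): for `ψ ∈ {ψ₀, ψ₀ ω}` unitary,
   trivial on `A_G`, `(s - 1)^{[ψ = 1]} L^T(s, ψ)` is entire with non-zero value at `1`
   (`T = S ∪ {ramified places of ψ}`); the finitely many factors `(1 - ψ(ϖ_v) q_v^{-s})⁻¹`,
   `v ∈ T ∖ S`, are holomorphic and non-zero on `{0 < Re s}` (partial versus complete: finitely
   many local factors).
6. *Order count* (p. 206): exactly one of `ψ₀`, `ψ₀ ω` is trivial (`ω ≠ 1`, `ω² = 1`); the sign is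
   `η = +1` iff `ψ₀ = 1` (conjugate-orthogonal) and `η = -1` iff `ψ₀ = ω` (conjugate-symplectic).

## References

* C. P. Mok, *Endoscopic classification of representations of quasi-split unitary groups*,
  Mem. Amer. Math. Soc. 235 (2015), no. 1108 (arXiv:1206.0882): §2.2 (p. 8), §2.5 and
  Thm. 2.5.4 (a) (p. 20). [Mok2014]
* N. Grbac, F. Shahidi, *Endoscopic transfer for unitary groups and holomorphy of Asai
  `L`-functions*, Pacific J. Math. 276 (2015), 185–211: Thm. 4.3 (pp. 186, 204), §2.A (p. 190),
  proof pp. 204–206. [GrbacShahidi2015]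
* Y. Z. Flicker, *Twisted tensors and Euler products*, Bull. Soc. Math. France 116 (1988), 295–313,
  pp. 305–306. [Flicker1988]
* J. Tate, *Fourier analysis in number fields and Hecke's zeta-functions*, Thm. 4.4.1, and
  *Global class field theory*, Ch. VII §4 Prop. 4.1, §5.1 Main Theorem (B), in Cassels–Fröhlich,
  *Algebraic Number Theory* (1967). [TateThesis1967] [CasselsFrohlichANT1967]
* K. Iwasawa, *Hecke's `L`-functions* (Princeton lectures 1964), SpringerBriefs (2019), Thm. 3.1,
  Prop. 4.4. [Iwasawa2019]
* J. Neukirch, *Algebraic Number Theory* (1999), Ch. VII (5.11), (8.1). [NeukirchANT1999]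
* J. Arthur, L. Clozel, *Simple algebras, base change, and the advanced theory of the trace
  formula*, Ann. of Math. Stud. 120 (1989), Ch. 3, proof of Thm. 3.1 (p. 201) (the values `ω(ϖ_v)`).
  [ArthurClozelAMS120]
-/

noncomputable section

open scoped Topology NNReal Classical
open NumberField IsDedekindDomain Filter

namespace Literature.NumberTheory.Automorphic

open Literature.NumberTheory.GaloisRepresentations

/-! ### Characters on `A_G = ℝ_{>0}` and Hecke's entire continuation of partial `L`-functions -/

/-- **If `e^{u s} = 1` for every real `u`, then `s = 0`** (`u = 1` gives `s = 2πi n`; if `n ≠ 0`,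
`u = 1/(2n)` gives `e^{πi} = 1`). [folklore] -/
theorem eq_zero_of_forall_exp_ofReal_mul_eq_one {s : ℂ} (h : ∀ u : ℝ, Complex.exp (u * s) = 1) :
    s = 0 := by
  by_contra hs
  obtain ⟨n, hn⟩ := Complex.exp_eq_one_iff.mp (by simpa using h 1)
  have hn0 : (n : ℂ) ≠ 0 := by
    intro h0
    apply hs
    rw [hn, h0, zero_mul]
  have h2 := h (1 / (2 * n))
  have key : (((1 / (2 * (n : ℝ)) : ℝ)) : ℂ) * s = Real.pi * Complex.I := by
    rw [hn]
    push_cast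
    field_simp
  rw [key, Complex.exp_pi_mul_I] at h2
  norm_num at h2

section HeckeLemmas

variable {K : Type} [Field K] [NumberField K]

/-- **A norm power `‖·‖^{s₁}` whose square is trivial on `A_G = ℝ_{>0}` is trivial: `s₁ = 0`**
(`‖r‖ = r^{[K:ℚ]}` on `A_G`, `ideleNorm_posRealIdele_holds`, so `r^{2 [K:ℚ] s₁} = 1` for all `r > 0`).
[folklore] -/
theorem _root_.Literature.NumberTheory.GaloisRepresentations.HeckeCharacter.eq_zero_of_normTwist_sq_posRealIdele
    {ν : HeckeCharacter K} {s₁ : ℂ}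
    (hν : ∀ x : ideleGroup K, ((ν x : ℂˣ) : ℂ) = ((ideleNorm x : ℝ) : ℂ) ^ s₁)
    (h : ∀ r : ℝ≥0ˣ, ((ν (posRealIdele K r) : ℂˣ) : ℂ) * ((ν (posRealIdele K r) : ℂˣ) : ℂ) = 1) :
    s₁ = 0 := by
  set d : ℕ := Module.finrank ℚ K with hd
  have hd0 : (d : ℂ) ≠ 0 := Nat.cast_ne_zero.mpr Module.finrank_pos.ne'
  have hνr : ∀ r : ℝ≥0ˣ, ((ν (posRealIdele K r) : ℂˣ) : ℂ) =
      Complex.exp ((d * Real.log ((r : ℝ≥0) : ℝ)) * s₁) := by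
    intro r
    have hr : (0 : ℝ) < ((r : ℝ≥0) : ℝ) := NNReal.coe_pos.mpr (pos_iff_ne_zero.mpr r.ne_zero)
    have hr0 : ((((r : ℝ≥0) : ℝ) : ℂ)) ^ d ≠ 0 := pow_ne_zero _ (Complex.ofReal_ne_zero.mpr hr.ne')
    rw [hν, ← coe_ideleNorm, ideleNorm_posRealIdele_holds K r, NNReal.coe_pow, Complex.ofReal_pow,
      Complex.cpow_def_of_ne_zero hr0, ← Complex.ofReal_pow, ← Complex.ofReal_log (pow_nonneg hr.le _),
      Real.log_pow]
    push_cast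
    ring
  suffices h2 : (2 * d : ℂ) * s₁ = 0 by
    rcases mul_eq_zero.mp h2 with h | h
    · exact absurd h (mul_ne_zero two_ne_zero hd0)
    · exact h
  refine eq_zero_of_forall_exp_ofReal_mul_eq_one fun u => ?_
  set r : ℝ≥0ˣ := Units.mk0 ⟨Real.exp u, (Real.exp_pos u).le⟩
    (by rw [Ne, ← NNReal.coe_eq_zero]; exact (Real.exp_pos u).ne') with hrdef
  have hr : (((r : ℝ≥0)) : ℝ) = Real.exp u := rfl
  have h1 := h r
  rw [hνr r, hr, Real.log_exp, ← Complex.exp_add] at h1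
  rw [← h1]
  congr 1
  ring

/-- **A Hecke character with `η² = 1` is trivial on `A_G = ℝ_{>0}`** (every `t > 0` is a square).
[folklore] -/
theorem _root_.Literature.NumberTheory.GaloisRepresentations.HeckeCharacter.map_posRealIdele_eq_one_of_sq
    {η : HeckeCharacter K} (h : η ^ 2 = 1) (t : ℝ≥0ˣ) : η (posRealIdele K t) = 1 := by
  set s : ℝ≥0ˣ := Units.mk0 (NNReal.sqrt (t : ℝ≥0)) (by
    rw [Ne, NNReal.sqrt_eq_zero]; exact t.ne_zero) with hs
  have hts : t = s * s := by
    ext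
    simp [hs, NNReal.mul_self_sqrt]
  rw [hts, map_mul, map_mul, ← HeckeCharacter.mul_apply, ← pow_two, h, HeckeCharacter.one_apply]

/-- `1(ϖ_v) = 1` (a copy of the private `valueAtUniformizer_one` lemmas of the sibling files).
[folklore] -/
private theorem valueAtUniformizer_one_contRankOne (v : HeightOneSpectrum (𝓞 K)) :
    (1 : HeckeCharacter K).valueAtUniformizer v = 1 := by
  rw [HeckeCharacter.valueAtUniformizer, HeckeCharacter.localComponent_apply,
    HeckeCharacter.one_apply, Units.val_one]

/-- **Hecke's continuation of a partial `L`-function, entire form.** For a unitary Hecke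
character `ψ` of `K` trivial on `A_G` and unramified off the finite `T`: there are `k`
(`= 1` iff `ψ = 1`) and an ENTIRE `G` with `G(s) = (s - 1)^k L^T(s, ψ)` for `Re s > 1` and
`G(1) ≠ 0` — for `ψ ≠ 1`, `L^T(s, ψ)` is entire and `≠ 0` at `s = 1` (Hecke 1917 / Landau:
`exists_entire_forall_ne_zero_eq_partialHeckeL`); for `ψ = 1`, `(s - 1) ζ_K(s)` is entire with
value the residue `≠ 0` at `1` (`differentiable_update_sub_one_mul_dedekindZetaCont`) and the
finitely many removed factors `1 - q_v^{-s}` are entire, `≠ 0` at `1`. (The sibling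
`exists_continuation_partialHeckeL_shift` of `AsaiAtOneRankOne` records only holomorphy on
`{1 < Re s} ∪ B(1, δ)`.) [cite: Iwasawa2019, Thm. 3.1 and Ch. 4 §4.2 Prop. 4.4]
[cite: NeukirchANT1999, Ch. VII (5.11)] -/
theorem exists_entire_continuation_partialHeckeL (ψ : HeckeCharacter K) (hu : ψ.IsUnitary)
    (hA : ∀ t : ℝ≥0ˣ, ψ (posRealIdele K t) = 1) {T : Set (HeightOneSpectrum (𝓞 K))} (hT : T.Finite)
    (hur : ∀ v ∉ T, ψ.IsUnramifiedAt v) :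
    ∃ (k : ℕ) (G : ℂ → ℂ), (k = if ψ = 1 then 1 else 0) ∧ Differentiable ℂ G ∧
      (∀ s : ℂ, 1 < s.re → G s = (s - 1) ^ k * ∏' v : {v : HeightOneSpectrum (𝓞 K) // v ∉ T},
        (1 - ψ.valueAtUniformizer v.1 * ((v.1.residueCard : ℂ) ^ (-s)))⁻¹) ∧
      G 1 ≠ 0 := by
  by_cases hψ : ψ = 1
  · subst hψ
    refine ⟨1, fun s => Function.update (fun s : ℂ => (s - 1) * LFunctions.dedekindZetaCont K s)
      1 ((_root_.NumberField.dedekindZeta_residue K : ℝ) : ℂ) s *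
        ∏ v ∈ hT.toFinset, (1 - ((v.residueCard : ℂ) ^ (-s))), by simp, ?_, ?_, ?_⟩
    · exact (differentiable_update_sub_one_mul_dedekindZetaCont (K := K)).mul
        (Differentiable.fun_finsetProd fun v _ => differentiable_one_sub_residueCard_cpow_neg v)
    · intro s hs
      dsimp only
      have hs1 : s ≠ 1 := fun h => by rw [h, Complex.one_re] at hs; exact lt_irrefl _ hs
      rw [Function.update_of_ne hs1, pow_one, mul_assoc,
        ← tprod_eulerFactor_one_eq_dedekindZetaCont_mul_prod hT hs]
      congr 1
      refine tprod_congr fun v => ?_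
      rw [valueAtUniformizer_one_contRankOne, one_mul]
    · dsimp only
      rw [Function.update_self]
      refine mul_ne_zero ?_ (Finset.prod_ne_zero_iff.mpr fun v _ => ?_)
      · exact_mod_cast (_root_.NumberField.dedekindZeta_residue_pos K).ne'
      · exact one_sub_residueCard_cpow_neg_ne_zero v (by rw [Complex.one_re]; exact one_pos)
  · obtain ⟨g, hg, hg0, hg_eq⟩ := exists_entire_forall_ne_zero_eq_partialHeckeL ψ hu hA hψ hT hur
    exact ⟨0, g, by simp [hψ], hg, fun s hs => by rw [pow_zero, one_mul, hg_eq _ hs],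
      hg0 _ Complex.one_re⟩

end HeckeLemmas

/-! ### Class field theory of the quadratic extension: `ψ₀ ∈ {1, ω}` and the values `ω(ϖ_v)` -/

section ClassField

variable {F E : Type} [Field F] [NumberField F] [Field E] [NumberField E] [Algebra F E]

/-- **A character of `𝕀_F / F^× N(𝕀_E)` is `1` or the class-field character when the norm
index is `2`**: if `ψ` is trivial on `N = F^× N(𝕀_E)`, `η` vanishes exactly on `N` and
`[𝕀_F : N] = 2`, then `ψ = 1` or `ψ = η` (both take the value `-1` off `N`: squares lie in `N`,
and `x x₀ ∈ N` for `x, x₀ ∉ N`). [cite: CasselsFrohlichANT1967, Ch. VII §5.1 Main Theorem (B)] -/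
theorem _root_.Literature.NumberTheory.GaloisRepresentations.HeckeCharacter.IsTrivialOnNormGroup.eq_one_or_eq_of_index_two
    [FiniteDimensional F E] {ψ η : HeckeCharacter F} (hψ : ψ.IsTrivialOnNormGroup E)
    (hη : η.IsClassFieldCharacter E) (h2 : (normGroup F E).index = 2) : ψ = 1 ∨ ψ = η := by
  by_cases h1 : ψ = 1
  · exact Or.inl h1
  right
  obtain ⟨x₀, hx₀⟩ : ∃ x₀, ψ x₀ ≠ 1 := by
    by_contra h
    push Not at h
    exact h1 (HeckeCharacter.ext fun x => by rw [h x, HeckeCharacter.one_apply])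
  have hx₀N : x₀ ∉ normGroup F E := fun h => hx₀ (hψ x₀ h)
  -- a character trivial on `N` but not at `x₀` takes the value `-1` there
  have hval : ∀ {θ : HeckeCharacter F}, (∀ x ∈ normGroup F E, θ x = 1) → θ x₀ ≠ 1 → θ x₀ = -1 := by
    intro θ hθ hne
    have hsq : θ x₀ * θ x₀ = 1 := by
      rw [← map_mul]
      exact hθ _ (Subgroup.mul_self_mem_of_index_two h2 x₀)
    have hsq' : ((θ x₀ : ℂˣ) : ℂ) * ((θ x₀ : ℂˣ) : ℂ) = 1 := by
      rw [← Units.val_mul, hsq, Units.val_one]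
    rcases mul_self_eq_one_iff.mp hsq' with h | h
    · exact absurd (Units.val_eq_one.mp h) hne
    · exact Units.val_inj.mp (by rw [h, Units.val_neg, Units.val_one])
  have hψx₀ : ψ x₀ = -1 := hval hψ hx₀
  have hηx₀ : η x₀ = -1 := hval hη.isTrivialOnNormGroup fun h => hx₀N ((hη x₀).mp h)
  refine HeckeCharacter.ext fun x => ?_
  by_cases hx : x ∈ normGroup F E
  · rw [hψ x hx, (hη x).mpr hx]
  · have hxx₀ : x * x₀ ∈ normGroup F E :=
      (Subgroup.mul_mem_iff_of_index_two h2).mpr (iff_of_false hx hx₀N)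
    have e1 : ψ x * ψ x₀ = 1 := by rw [← map_mul]; exact hψ _ hxx₀
    have e2 : η x * η x₀ = 1 := by rw [← map_mul]; exact (hη _).mpr hxx₀
    rw [hψx₀] at e1
    rw [hηx₀] at e2
    calc ψ x = (ψ x * -1) * -1 := by rw [mul_assoc, neg_one_mul, neg_neg, mul_one]
      _ = (η x * -1) * -1 := by rw [e1, e2]
      _ = η x := by rw [mul_assoc, neg_one_mul, neg_neg, mul_one]

/-- **The class-field character of a quadratic extension at the places above an Asai datum**:
`ω(ϖ_v) = -1` if the place `w_v` above `v` is `c`-fixed (inert: `e = 1`, `f = 2`, a primitive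
square root of unity) and `ω(ϖ_v) = 1` otherwise (split: `e = f = 1`) —
`IsClassFieldCharacter.isPrimitiveRoot_valueAtUniformizer` (Artin reciprocity for the quadratic
character, a theorem of the tree) read through `e f g = 2`. [cite: ArthurClozelAMS120, Ch. 3, proof of Thm. 3.1 (p. 201)] -/
theorem _root_.Literature.NumberTheory.GaloisRepresentations.HeckeCharacter.IsClassFieldCharacter.valueAtUniformizer_eq_ite_smul
    (h2 : Module.finrank F E = 2) {c : E ≃ₐ[F] E} {ω : HeckeCharacter F}
    (hω : ω.IsClassFieldCharacter E) {v : HeightOneSpectrum (𝓞 F)}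
    (hinert : ∀ w : HeightOneSpectrum (𝓞 E), w.under (𝓞 F) = v → c • w = w →
      w.asIdeal.inertiaDeg (𝓞 F) = 2) :
    ω.valueAtUniformizer v = if c • placeAbove E v = placeAbove E v then -1 else 1 := by
  haveI : Algebra.IsQuadraticExtension F E := { finrank_eq_two' := h2 }
  have hprime : (Module.finrank F E).Prime := by rw [h2]; exact Nat.prime_two
  have hw₀ : (placeAbove E v).under (𝓞 F) = v := placeAbove_under v
  by_cases hfix : c • placeAbove E v = placeAbove E v
  · obtain ⟨he, hf⟩ :=
      HeightOneSpectrum.ramificationIdxIn_eq_one_of_inertiaDeg_eq_two h2 (hinert _ hw₀ hfix)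
    rw [hw₀] at he hf
    rw [if_pos hfix]
    have h := hω.isPrimitiveRoot_valueAtUniformizer hprime he
    rw [hf] at h
    exact h.eq_neg_one_of_two_right
  · obtain ⟨he, hf⟩ := HeightOneSpectrum.ramificationIdxIn_eq_one_of_smul_ne h2 hfix
    rw [hw₀] at he hf
    rw [if_neg hfix]
    have h := hω.isPrimitiveRoot_valueAtUniformizer hprime he
    rw [hf] at h
    exact IsPrimitiveRoot.one_right_iff.mp h

end ClassField

/-! ### Conjugate self-duality almost everywhere, for a Hecke character of `E` -/

section ConjSelfDual

variable {F E : Type} [Field F] [NumberField F] [Field E] [NumberField E] [Algebra F E]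

omit [NumberField F] in
/-- **Conjugate self-duality almost everywhere makes a Hecke character of `E` unitary-normalised
and exactly conjugate self-dual.** Let `c` be an `F`-automorphism of the number field `E` (below:
`E/F` quadratic, `c ≠ 1`), `χ = χ₀ ‖·‖^{s₁}` a Hecke character of `E` with `χ₀` trivial on `A_G`,
and suppose `χ(ϖ_{c w}) = χ(ϖ_w)⁻¹` for almost all `w`. Then `s₁ = 0` and `χ₀ · (χ₀ ∘ c) = 1`: the
Hecke character `ρ = χ₀ (χ₀ ∘ c) ‖·‖^{2 s₁}` has `ρ(ϖ_w) = χ(ϖ_w) χ(ϖ_{c w}) = 1` for almost all `w`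
(`q_{c w} = q_w`, `residueCard_smul`), hence `ρ = 1` (rigidity, Cassels–Fröhlich VII Prop. 4.1), and
on `A_G` this reads `r^{2 [E:ℚ] s₁} = 1`. [cite: CasselsFrohlichANT1967, Ch. VII §4 Prop. 4.1 (proof)] -/
theorem _root_.Literature.NumberTheory.GaloisRepresentations.HeckeCharacter.normTwist_eq_zero_of_conjSelfDual
    {c : E ≃ₐ[F] E} {χ χ₀ ν χ₀c : HeckeCharacter E} {s₁ : ℂ}
    (hν : ∀ x : ideleGroup E, ((ν x : ℂˣ) : ℂ) = ((ideleNorm x : ℝ) : ℂ) ^ s₁) (hχ : χ = χ₀ * ν)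
    (hχ₀A : ∀ r : ℝ≥0ˣ, χ₀ (posRealIdele E r) = 1) (hχ₀c : ∀ x, χ₀c x = χ₀ (c • x))
    (hcsd : ∀ᶠ w : HeightOneSpectrum (𝓞 E) in cofinite,
      χ.valueAtUniformizer (c • w) = (χ.valueAtUniformizer w)⁻¹) :
    s₁ = 0 ∧ χ₀ * χ₀c = 1 := by
  -- `χ₀` is unramified at `c • w` for almost all `w`
  have hχ₀ur : ∀ᶠ w : HeightOneSpectrum (𝓞 E) in cofinite, χ₀.IsUnramifiedAt w :=
    χ₀.finite_ramifiedPlaces_iff.1 (HeckeCharacter.finite_ramifiedPlaces_holds χ₀)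
  have hχ₀ur' : ∀ᶠ w : HeightOneSpectrum (𝓞 E) in cofinite, χ₀.IsUnramifiedAt (c • w) :=
    (MulAction.injective c).tendsto_cofinite.eventually hχ₀ur
  -- `ρ = χ₀ χ₀c ν²` is trivial at almost every uniformizer, hence trivial
  set ρ : HeckeCharacter E := χ₀ * χ₀c * (ν * ν) with hρ
  have hρ1 : ρ = 1 := by
    refine HeckeCharacter.eq_one_of_eventually_valueAtUniformizer_eq_one ?_
    filter_upwards [hcsd, hχ₀ur'] with w hw hur
    have hχw : χ.valueAtUniformizer w =
        χ₀.valueAtUniformizer w * ((w.residueCard : ℂ)) ^ (-s₁) := by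
      rw [hχ, HeckeCharacter.valueAtUniformizer_mul, HeckeCharacter.valueAtUniformizer_normTwist hν]
    have hχcw : χ.valueAtUniformizer (c • w) =
        χ₀.valueAtUniformizer (c • w) * ((w.residueCard : ℂ)) ^ (-s₁) := by
      rw [hχ, HeckeCharacter.valueAtUniformizer_mul, HeckeCharacter.valueAtUniformizer_normTwist hν,
        residueCard_smul F c w]
    have hne : χ.valueAtUniformizer w ≠ 0 := by
      simp only [HeckeCharacter.valueAtUniformizer]
      exact Units.ne_zero _
    rw [hρ, HeckeCharacter.valueAtUniformizer_mul, HeckeCharacter.valueAtUniformizer_mul,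
      HeckeCharacter.valueAtUniformizer_mul, HeckeCharacter.valueAtUniformizer_galConj hχ₀c hur,
      HeckeCharacter.valueAtUniformizer_normTwist hν]
    calc χ₀.valueAtUniformizer w * χ₀.valueAtUniformizer (c • w) *
          (((w.residueCard : ℂ)) ^ (-s₁) * ((w.residueCard : ℂ)) ^ (-s₁))
        = χ.valueAtUniformizer w * χ.valueAtUniformizer (c • w) := by rw [hχw, hχcw]; ring
      _ = 1 := by rw [hw, mul_inv_cancel₀ hne]
  -- on `A_G`: `ν(r)² = 1`, so `s₁ = 0`
  have hs₁ : s₁ = 0 := by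
    refine HeckeCharacter.eq_zero_of_normTwist_sq_posRealIdele hν fun r => ?_
    have h := congrArg (fun θ : HeckeCharacter E => ((θ (posRealIdele E r) : ℂˣ) : ℂ)) hρ1
    simp only [hρ, HeckeCharacter.mul_apply, HeckeCharacter.one_apply, hχ₀c, smul_posRealIdele,
      hχ₀A, one_mul, Units.val_mul, Units.val_one] at h
    exact h
  refine ⟨hs₁, ?_⟩
  have hν1 : ν = 1 := HeckeCharacter.ext fun x => Units.ext (by
    rw [hν, hs₁, Complex.cpow_zero, HeckeCharacter.one_apply, Units.val_one])
  rw [hρ, hν1, mul_one, mul_one] at hρ1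
  exact hρ1

/-- **`χ₀ · (χ₀ ∘ c) = 1` makes `χ₀|_{𝕀_F}` a character of `𝕀_F / F^× N(𝕀_E)`**: the restriction
`ψ₀` of `χ₀` kills `F^×` (it is a Hecke character) and the norms `N y = y · (c • y)`
(`ideleGalNorm_eq_mul_smul`), on which it is `χ₀(y) χ₀(c • y) = 1`. [folklore] -/
theorem _root_.Literature.NumberTheory.GaloisRepresentations.HeckeCharacter.isTrivialOnNormGroup_of_mul_galConj_eq_one
    (h2 : Module.finrank F E = 2) {c : E ≃ₐ[F] E} (hc : c ≠ 1) {χ₀ χ₀c : HeckeCharacter E}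
    {ψ₀ : HeckeCharacter F} (hψ₀ : ∀ x, ψ₀ x = χ₀ (AdeleRing.ideleBaseChange F E x))
    (hχ₀c : ∀ x, χ₀c x = χ₀ (c • x)) (hΘ : χ₀ * χ₀c = 1) :
    haveI : FiniteDimensional F E := Module.finite_of_finrank_eq_succ h2
    ψ₀.IsTrivialOnNormGroup E := by
  haveI : FiniteDimensional F E := Module.finite_of_finrank_eq_succ h2
  intro x hx
  change x ∈ principalIdeles F ⊔ idelicNormSubgroup F E at hx
  obtain ⟨p, hp, z, hz, rfl⟩ := Subgroup.mem_sup.mp hx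
  obtain ⟨y, hy⟩ := mem_idelicNormSubgroup_iff.mp hz
  rw [map_mul, ψ₀.map_principal hp, one_mul, hψ₀, ← hy, ideleGalNorm_eq_mul_smul h2 hc, map_mul,
    ← hχ₀c, ← HeckeCharacter.mul_apply, hΘ, HeckeCharacter.one_apply]

end ConjSelfDual

/-! ### Continuation of partial Asai products whose unramified factors are Hecke factors -/

section Continuation

variable {F E : Type} [Field F] [NumberField F] [Field E] [NumberField E] [Algebra F E]

omit [NumberField E] in
/-- **Multipliability of a partial Asai product whose unramified factors are Hecke factors**: if
`det(1 - As^θ(t_v) T) = 1 - ψ(ϖ_v) T` at every `v ∉ S` for a unitary Hecke character `ψ` of `F`,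
the product over `v ∉ S` is multipliable for `Re s > 1` (Neukirch VII (8.1)).
[cite: NeukirchANT1999, Ch. VII Prop. (8.1)] -/
theorem multipliable_asaiEulerFactor_of_heckeCharacter {S : Set (HeightOneSpectrum (𝓞 F))}
    (c : E ≃ₐ[F] E) (A : SatakeFamily E) (θ : ℤˣ) {ψ : HeckeCharacter F} (hu : ψ.IsUnitary)
    (hfac : ∀ v ∉ S, ∀ x : ℂ,
      (asaiLocalPolynomial c A θ (placeAbove E v)).eval x = 1 - ψ.valueAtUniformizer v * x)
    {s : ℂ} (hs : 1 < s.re) :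
    Multipliable fun v : {v : HeightOneSpectrum (𝓞 F) // v ∉ S} =>
      ((asaiLocalPolynomial c A θ (placeAbove E v.1)).eval ((v.1.residueCard : ℂ) ^ (-s)))⁻¹ := by
  have h := multipliable_twistedEulerFactor (ε := fun _ => (1 : ℂ)) hu S (fun _ => by simp) hs
  refine (multipliable_congr fun v => ?_).mpr h
  rw [hfac v.1 v.2, one_mul]

omit [NumberField E] in
/-- The partial Asai `L`-function off `S` as the Hecke Euler product of `ψ` off `S`, under the same
identification of the unramified factors. [folklore] -/
theorem partialAsaiL_eq_tprod_of_heckeCharacter {S : Set (HeightOneSpectrum (𝓞 F))}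
    (c : E ≃ₐ[F] E) (A : SatakeFamily E) (θ : ℤˣ) {ψ : HeckeCharacter F}
    (hfac : ∀ v ∉ S, ∀ x : ℂ,
      (asaiLocalPolynomial c A θ (placeAbove E v)).eval x = 1 - ψ.valueAtUniformizer v * x)
    (s : ℂ) :
    partialAsaiL S c A θ s = ∏' v : {v : HeightOneSpectrum (𝓞 F) // v ∉ S},
      (1 - ψ.valueAtUniformizer v.1 * ((v.1.residueCard : ℂ) ^ (-s)))⁻¹ :=
  tprod_congr fun v => by rw [hfac v.1 v.2]

omit [NumberField E] in
/-- **Hecke–Tate continuation of a partial Asai `L`-function whose unramified factors are Hecke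
factors.** If `det(1 - As^θ(t_v) T) = 1 - ψ(ϖ_v) T` at every `v ∉ S` (`S` finite) for a unitary
Hecke character `ψ` of `F` trivial on `A_G`, then `(s - 1)^k L^S(s, A, As^θ)` (`k = 1` iff `ψ = 1`)
extends from `{1 < Re s}` to a function holomorphic on `{1/2 < Re s}` and non-zero at `s = 1`:
Hecke's entire continuation of `L^{S'}(s, ψ)` over `S' = S ∪ {ramified places of ψ}`
(`exists_entire_continuation_partialHeckeL`), times the finitely many removed factors
`(1 - ψ(ϖ_v) q_v^{-s})⁻¹`, `v ∈ S' ∖ S`, holomorphic and non-zero on `{0 < Re s}`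
(`partialAsaiL_eq_prod_mul_partialAsaiL`). [cite: Iwasawa2019, Thm. 3.1 and Ch. 4 §4.2 Prop. 4.4] -/
theorem exists_continuation_partialAsaiL_of_heckeCharacter {S : Set (HeightOneSpectrum (𝓞 F))}
    (hS : S.Finite) (c : E ≃ₐ[F] E) (A : SatakeFamily E) (θ : ℤˣ) {ψ : HeckeCharacter F}
    (hu : ψ.IsUnitary) (hA : ∀ t : ℝ≥0ˣ, ψ (posRealIdele F t) = 1)
    (hfac : ∀ v ∉ S, ∀ x : ℂ,
      (asaiLocalPolynomial c A θ (placeAbove E v)).eval x = 1 - ψ.valueAtUniformizer v * x) :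
    ∃ (k : ℕ) (G : ℂ → ℂ), (k = if ψ = 1 then 1 else 0) ∧
      DifferentiableOn ℂ G {s : ℂ | 1 / 2 < s.re} ∧
      (∀ s : ℂ, 1 < s.re → G s = (s - 1) ^ k * partialAsaiL S c A θ s) ∧ G 1 ≠ 0 := by
  -- the ramified places `B` of `ψ`, and `S' = S ∪ B`
  have hψur : ∀ᶠ v : HeightOneSpectrum (𝓞 F) in cofinite, ψ.IsUnramifiedAt v :=
    ψ.finite_ramifiedPlaces_iff.1 (HeckeCharacter.finite_ramifiedPlaces_holds ψ)
  set B : Set (HeightOneSpectrum (𝓞 F)) := {v | ¬ ψ.IsUnramifiedAt v} with hB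
  have hBfin : B.Finite := Filter.eventually_cofinite.mp hψur
  set S' : Set (HeightOneSpectrum (𝓞 F)) := S ∪ B with hS'
  have hS'fin : S'.Finite := hS.union hBfin
  have hSS' : S ⊆ S' := Set.subset_union_left
  have hfin : (S' \ S).Finite := hS'fin.subset fun v hv => hv.1
  have hur : ∀ v ∉ S', ψ.IsUnramifiedAt v := fun v hv => by
    by_contra h
    exact hv (Or.inr h)
  have hfac' : ∀ v ∉ S', ∀ x : ℂ,
      (asaiLocalPolynomial c A θ (placeAbove E v)).eval x = 1 - ψ.valueAtUniformizer v * x :=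
    fun v hv => hfac v fun h => hv (hSS' h)
  -- Hecke's entire continuation of `L^{S'}(s, ψ)`
  obtain ⟨k, G', hk, hG'd, hG'eq, hG'1⟩ := exists_entire_continuation_partialHeckeL ψ hu hA hS'fin hur
  -- the removed factors, inverted: holomorphic and non-zero on `{0 < Re s}`
  set P : ℂ → ℂ := fun s => ∏ v ∈ hfin.toFinset,
    (1 - ψ.valueAtUniformizer v * ((v.residueCard : ℂ) ^ (-s)))⁻¹ with hP
  have hq : ∀ v : HeightOneSpectrum (𝓞 F), (v.residueCard : ℂ) ≠ 0 := fun v =>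
    Nat.cast_ne_zero.mpr (ne_of_gt (lt_trans zero_lt_one v.one_lt_residueCard))
  have hfne : ∀ (v : HeightOneSpectrum (𝓞 F)) (s : ℂ), 0 < s.re →
      1 - ψ.valueAtUniformizer v * ((v.residueCard : ℂ) ^ (-s)) ≠ 0 := fun v s hs => by
    have h := one_sub_twistedEulerDatum_ne_zero (ε := fun _ => (1 : ℂ)) hu (fun _ => by simp) v hs
    rwa [one_mul] at h
  have hPd : DifferentiableOn ℂ P {s : ℂ | 0 < s.re} := by
    refine DifferentiableOn.fun_finsetProd fun v _ => ?_
    refine DifferentiableOn.inv ?_ fun s hs => hfne v s hs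
    exact ((differentiable_const _).sub
      ((differentiable_id.neg.const_cpow (Or.inl (hq v))).const_mul _)).differentiableOn
  have hP1 : P 1 ≠ 0 := Finset.prod_ne_zero_iff.mpr fun v _ =>
    inv_ne_zero (hfne v 1 (by rw [Complex.one_re]; exact one_pos))
  -- `L^S = P · L^{S'}` on `{1 < Re s}`
  have hLS : ∀ s : ℂ, 1 < s.re → partialAsaiL S c A θ s = P s * partialAsaiL S' c A θ s := by
    intro s hs
    rw [partialAsaiL_eq_prod_mul_partialAsaiL hSS' hfin c A θ
      (multipliable_asaiEulerFactor_of_heckeCharacter c A θ hu hfac' hs)]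
    congr 1
    refine Finset.prod_congr rfl fun v hv => ?_
    rw [hfac v (hfin.mem_toFinset.mp hv).2]
  refine ⟨k, fun s => P s * G' s, hk, ?_, ?_, mul_ne_zero hP1 hG'1⟩
  · refine (hPd.mono fun s hs => ?_).mul hG'd.differentiableOn
    simp only [Set.mem_setOf_eq] at hs ⊢
    linarith
  · intro s hs
    show P s * G' s = _
    rw [hG'eq s hs, ← partialAsaiL_eq_tprod_of_heckeCharacter c A θ hfac' s, hLS s hs]
    ring

end Continuation

/-! ### The theorem -/

section RankOne

variable {F E : Type} [Field F] [NumberField F] [Field E] [NumberField E] [Algebra F E]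

/-- **Mok's Asai-pole dichotomy in continuation form (`Mok2014_partialAsaiL_continuation_pole_dichotomy`)
for `GL(1)`, proved.** For a quadratic extension `E/F` of number fields with non-trivial
automorphism `c` and a cuspidal automorphic representation datum `π` of `GL₁(𝔸_E)` which is
conjugate self-dual almost everywhere on Satake parameters, there is a sign `η` such that for every
Asai datum `(S, A)` of `π` (with `σ₀ = 1`): (i) both partial Asai Euler products are multipliable on
`{1 < Re s}`; (ii) `(s - 1) L^S(s, π, As^η)` extends to a function holomorphic on `{1/2 < Re s}` and
non-zero at `1`; (iii) `L^S(s, π, As^{-η})` extends to a function holomorphic on `{1/2 < Re s}` and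
non-zero at `1` — verbatim the conclusion of the named fact at `N = 1`.

Proof (Grbac–Shahidi's pp. 204–206 in their degenerate instance, where the Langlands–Shahidi
method is Hecke–Tate theory and "`σ` Galois self-dual" is class field theory of the quadratic
extension; every input is a theorem of the tree): `π` acts through a Hecke character
`χ = χ₀ ‖·‖^{s₁}` of `E` (`χ₀` trivial on `A_G`); conjugate self-duality a.e. forces `s₁ = 0` and
`χ₀ (χ₀ ∘ c) = 1` (`HeckeCharacter.normTwist_eq_zero_of_conjSelfDual`, rigidity of Hecke
characters), so `ψ₀ = χ₀|_{𝕀_F}` is a character of `𝕀_F / F^× N(𝕀_E)`, a group of order `2`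
(`index_normGroup_eq_finrank_of_isCyclic`, Tate's Main Theorem (B) for the cyclic `E/F`), whence
`ψ₀ ∈ {1, ω_{E/F}}` with `ω_{E/F}` the class-field character (`exists_isClassFieldCharacter_holds`);
by Flicker's unramified computation in rank one (`eval_asaiLocalPolynomial_rankOne`) and the
decomposition law `ω_{E/F}(ϖ_v) = -1` at inert, `+1` at split unramified `v` (Artin reciprocity,
`IsClassFieldCharacter.isPrimitiveRoot_valueAtUniformizer`), `L^S(s, π, As⁺) = L_F^S(s, ψ₀)` and
`L^S(s, π, As⁻) = L_F^S(s, ψ₀ ω_{E/F})` factor by factor; exactly one of `ψ₀`, `ψ₀ ω_{E/F}` is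
trivial, its partial `L`-function is `ζ_F^S` (entire after multiplication by `s - 1`, residue `≠ 0`),
the other is entire and non-zero at `s = 1` (Hecke 1917, Landau; `exists_entire_continuation_partialHeckeL`,
`exists_continuation_partialAsaiL_of_heckeCharacter`).
[cite: Mok2014, §2.5 (paragraph before Thm. 2.5.4) and Thm. 2.5.4 (a)]
[cite: GrbacShahidi2015, Thm. 4.3 (2), §2.A p. 190 and proof pp. 204–206]
[cite: Flicker1988, pp. 305–306] [cite: CasselsFrohlichANT1967, Ch. VII §5.1 Main Theorem (B)]
[cite: TateThesis1967, Thm. 4.4.1] -/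
theorem Mok2014_partialAsaiL_continuation_pole_dichotomy_rank_one
    (F E : Type) [Field F] [NumberField F] [Field E] [NumberField E] [Algebra F E] (c : E ≃ₐ[F] E)
    (h2 : Module.finrank F E = 2) (hc : c ≠ 1) (hcpt : isCompact_glFiniteIntegralLevel 1 E)
    (π : CuspidalAutomorphicRepData 1 E hcpt) (hπ : π.1.IsConjSelfDualAE c) :
    ∃ η : ℤˣ, ∀ (S : Set (HeightOneSpectrum (𝓞 F))) (A : SatakeFamily E),
      π.1.IsAsaiDatum c S A →
        ∃ σ₀ : ℝ, 1 ≤ σ₀ ∧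
          (∀ (θ : ℤˣ) (s : ℂ), σ₀ < s.re →
            Multipliable fun v : {v : HeightOneSpectrum (𝓞 F) // v ∉ S} =>
              ((asaiLocalPolynomial c A θ (placeAbove E v.1)).eval
                ((v.1.residueCard : ℂ) ^ (-s)))⁻¹) ∧
          (∃ G : ℂ → ℂ, DifferentiableOn ℂ G {s : ℂ | 1 / 2 < s.re} ∧
            (∀ s : ℂ, σ₀ < s.re → G s = (s - 1) * partialAsaiL S c A η s) ∧ G 1 ≠ 0) ∧
          (∃ H : ℂ → ℂ, DifferentiableOn ℂ H {s : ℂ | 1 / 2 < s.re} ∧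
            (∀ s : ℂ, σ₀ < s.re → H s = partialAsaiL S c A (-η) s) ∧ H 1 ≠ 0) := by
  haveI hquad : Algebra.IsQuadraticExtension F E := { finrank_eq_two' := h2 }
  haveI : FiniteDimensional F E := Module.finite_of_finrank_eq_succ h2
  haveI : Fact (Module.finrank F E).Prime := ⟨by rw [h2]; exact Nat.prime_two⟩
  haveI : IsCyclic (E ≃ₐ[F] E) := isCyclic_of_prime_card (IsGalois.card_aut_eq_finrank F E)
  /- Step 1: the Hecke character `χ = χ₀ ‖·‖^{s₁}` of `π`; `ψ₀ = χ₀|_{𝕀_F}`, `χ₀c = χ₀ ∘ c` -/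
  obtain ⟨χ, hχπ⟩ := π.1.exists_heckeCharacter_glOne
  obtain ⟨χ₀, ν, s₁, hν, hχ, hχ₀A⟩ := χ.exists_eq_mul_normTwist
  have hχ₀u : χ₀.IsUnitary := HeckeCharacter.isUnitary_of_map_posRealIdele hχ₀A
  obtain ⟨ψ₀, hψ₀⟩ := χ₀.exists_restrict F
  obtain ⟨χ₀c, hχ₀c⟩ := χ₀.exists_galConj c
  have hψ₀u : ψ₀.IsUnitary := fun x => by rw [hψ₀]; exact hχ₀u _
  have hψ₀A : ∀ t : ℝ≥0ˣ, ψ₀ (posRealIdele F t) = 1 := fun t => by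
    rw [hψ₀, AdeleRing.ideleBaseChange_posRealIdele]
    exact hχ₀A t
  /- Step 2: the class-field character `ω` of `E/F`: `ω ≠ 1`, `ω² = 1` -/
  obtain ⟨ω, hω, hordω⟩ := (exists_isClassFieldCharacter_holds (F := F) (E := E) :
    ∃ η : HeckeCharacter F, η.IsClassFieldCharacter E ∧ orderOf η = Module.finrank F E)
  rw [h2] at hordω
  have hω1 : ω ≠ 1 := by
    intro h
    rw [h, orderOf_one] at hordω
    exact absurd hordω (by norm_num)
  have hω2 : ω ^ 2 = 1 := by rw [← hordω]; exact pow_orderOf_eq_one ω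
  have hωu : ω.IsUnitary := hω.isUnitary
  have hωA : ∀ t : ℝ≥0ˣ, ω (posRealIdele F t) = 1 :=
    HeckeCharacter.map_posRealIdele_eq_one_of_sq hω2
  /- the two Hecke characters `Ψ(+1) = ψ₀` (for `As⁺`) and `Ψ(-1) = ψ₀ ω` (for `As⁻`) -/
  set Ψ : ℤˣ → HeckeCharacter F := fun θ => if θ = 1 then ψ₀ else ψ₀ * ω with hΨ
  have hΨ1 : Ψ 1 = ψ₀ := if_pos rfl
  have hΨm : Ψ (-1) = ψ₀ * ω := if_neg (by decide)
  have hΨu : ∀ θ, (Ψ θ).IsUnitary := fun θ => by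
    rcases Int.units_eq_one_or θ with rfl | rfl
    · rw [hΨ1]; exact hψ₀u
    · rw [hΨm]; exact hψ₀u.mul hωu
  have hΨA : ∀ (θ : ℤˣ) (t : ℝ≥0ˣ), Ψ θ (posRealIdele F t) = 1 := fun θ t => by
    rcases Int.units_eq_one_or θ with rfl | rfl
    · rw [hΨ1]; exact hψ₀A t
    · rw [hΨm, HeckeCharacter.mul_apply, hψ₀A t, hωA t, one_mul]
  /- the sign: `+1` iff `ψ₀ = 1` -/
  refine ⟨if ψ₀ = 1 then 1 else -1, fun S A hSA => ?_⟩
  /- Step 3: above `v ∉ S`, `A w = {χ(ϖ_w)}` and `χ`, `χ₀` are unramified -/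
  have hAχ : ∀ w : HeightOneSpectrum (𝓞 E), w.under (𝓞 F) ∉ S →
      A w = {χ.valueAtUniformizer w} ∧ χ.IsUnramifiedAt w := fun w hw =>
    ⟨π.1.eq_singleton_valueAtUniformizer_glOne hχπ (hSA.hasSatakeParamAt hw),
      π.1.isUnramifiedAt_heckeCharacter_glOne' hχπ (hSA.hasSatakeParamAt hw)⟩
  have hν' : ∀ x : ideleGroup E, ((ν⁻¹ x : ℂˣ) : ℂ) = ((ideleNorm x : ℝ) : ℂ) ^ (-s₁) :=
    HeckeCharacter.inv_apply_of_forall_apply_eq_cpow hν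
  have hχ₀unr : ∀ w : HeightOneSpectrum (𝓞 E), χ.IsUnramifiedAt w → χ₀.IsUnramifiedAt w := by
    intro w hw
    have h0 : χ₀ = χ * ν⁻¹ := by rw [hχ, mul_inv_cancel_right]
    rw [h0]
    exact hw.mul (HeckeCharacter.IsNormTwist.isUnramifiedAt_holds ⟨-s₁, hν'⟩ w)
  have hunrv : ∀ v ∉ S, ∀ w : HeightOneSpectrum (𝓞 E), w.under (𝓞 F) = v → χ₀.IsUnramifiedAt w :=
    fun v hv w hw => hχ₀unr w (hAχ w (by rw [hw]; exact hv)).2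
  /- Step 4: conjugate self-duality a.e. ⇒ `s₁ = 0` and `χ₀ (χ₀ ∘ c) = 1` -/
  have hcsd : ∀ᶠ w : HeightOneSpectrum (𝓞 E) in cofinite,
      χ.valueAtUniformizer (c • w) = (χ.valueAtUniformizer w)⁻¹ := by
    have hπ' : ∀ᶠ w : HeightOneSpectrum (𝓞 E) in cofinite, ∀ α β : Multiset ℂ,
        π.1.HasSatakeParamAt w α → π.1.HasSatakeParamAt (c • w) β → β = α.map (·⁻¹) := hπ
    have hev : ∀ᶠ w : HeightOneSpectrum (𝓞 E) in cofinite, w.under (𝓞 F) ∉ S := by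
      rw [Filter.eventually_cofinite]
      simpa using finite_setOf_under_mem hSA.finite
    filter_upwards [hπ', hev] with w hw hwS
    have hcwS : (c • w).under (𝓞 F) ∉ S := by
      rwa [HeightOneSpectrum.under_algEquiv_smul F E c w]
    have h := hw (A w) (A (c • w)) (hSA.hasSatakeParamAt hwS) (hSA.hasSatakeParamAt hcwS)
    rw [(hAχ w hwS).1, (hAχ (c • w) hcwS).1, Multiset.map_singleton, Multiset.singleton_inj] at h
    exact h
  obtain ⟨hs₁, hΘ⟩ :=
    HeckeCharacter.normTwist_eq_zero_of_conjSelfDual hν hχ hχ₀A hχ₀c hcsd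
  subst hs₁
  /- Step 5: `ψ₀ ∈ {1, ω}`: `ψ₀` is a character of `𝕀_F / F^× N(𝕀_E)`, of order `2` -/
  have hψ₀N : ψ₀.IsTrivialOnNormGroup E :=
    HeckeCharacter.isTrivialOnNormGroup_of_mul_galConj_eq_one h2 hc hψ₀ hχ₀c hΘ
  have hidx : (normGroup F E).index = 2 := by rw [index_normGroup_eq_finrank_of_isCyclic, h2]
  have hψ₀cases : ψ₀ = 1 ∨ ψ₀ = ω := hψ₀N.eq_one_or_eq_of_index_two hω hidx
  /- Step 6: the unramified Asai factors are the Hecke factors of `Ψ θ`, at every `v ∉ S` -/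
  have hfac : ∀ (θ : ℤˣ), ∀ v ∉ S, ∀ x : ℂ,
      (asaiLocalPolynomial c A θ (placeAbove E v)).eval x =
        1 - (Ψ θ).valueAtUniformizer v * x := by
    intro θ v hv x
    have hinert : ∀ w : HeightOneSpectrum (𝓞 E), w.under (𝓞 F) = v → c • w = w →
        w.asIdeal.inertiaDeg (𝓞 F) = 2 :=
      fun w hw hcw => hSA.inertiaDeg_eq_two (by rw [hw]; exact hv) hcw
    have hωv := hω.valueAtUniformizer_eq_ite_smul h2 (c := c) hinert
    rw [eval_asaiLocalPolynomial_rankOne h2 hc hν hχ hψ₀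
      (fun w hw => (hAχ w (by rw [hw]; exact hv)).1) (hunrv v hv) hinert θ x,
      mul_zero, neg_zero, Complex.cpow_zero, mul_one]
    rcases Int.units_eq_one_or θ with rfl | rfl
    · have hite : (if c • placeAbove E v = placeAbove E v then ((((1 : ℤˣ) : ℤ)) : ℂ) else 1) = 1 := by
        split_ifs <;> simp
      rw [hite, one_mul, hΨ1]
    · have hite : (if c • placeAbove E v = placeAbove E v then ((((-1 : ℤˣ) : ℤ)) : ℂ) else 1) =
          ω.valueAtUniformizer v := by
        rw [hωv]
        split_ifs <;> simp
      rw [hite, hΨm, HeckeCharacter.valueAtUniformizer_mul]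
      ring
  /- Step 7: multipliability on `{1 < Re s}` and the continuations, for both signs -/
  have hmul : ∀ (θ : ℤˣ) (s : ℂ), 1 < s.re →
      Multipliable fun v : {v : HeightOneSpectrum (𝓞 F) // v ∉ S} =>
        ((asaiLocalPolynomial c A θ (placeAbove E v.1)).eval ((v.1.residueCard : ℂ) ^ (-s)))⁻¹ :=
    fun θ s hs => multipliable_asaiEulerFactor_of_heckeCharacter c A θ (hΨu θ) (hfac θ) hs
  have hcont : ∀ θ : ℤˣ, ∃ (k : ℕ) (G : ℂ → ℂ), (k = if Ψ θ = 1 then 1 else 0) ∧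
      DifferentiableOn ℂ G {s : ℂ | 1 / 2 < s.re} ∧
      (∀ s : ℂ, 1 < s.re → G s = (s - 1) ^ k * partialAsaiL S c A θ s) ∧ G 1 ≠ 0 := fun θ =>
    exists_continuation_partialAsaiL_of_heckeCharacter hSA.finite c A θ (hΨu θ) (hΨA θ) (hfac θ)
  /- Step 8: exactly one of `Ψ(±1)` is trivial — `Ψ(κ) = 1`, `Ψ(-κ) ≠ 1` for the sign `κ` -/
  set κ : ℤˣ := if ψ₀ = 1 then 1 else -1 with hκ
  have hΨκ : Ψ κ = 1 ∧ Ψ (-κ) ≠ 1 := by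
    rcases hψ₀cases with h0 | h0
    · have hκ1 : κ = 1 := if_pos h0
      refine ⟨by rw [hκ1, hΨ1, h0], ?_⟩
      rw [hκ1, hΨm, h0, one_mul]
      exact hω1
    · have hne : ψ₀ ≠ 1 := by rw [h0]; exact hω1
      have hκ1 : κ = -1 := if_neg hne
      refine ⟨by rw [hκ1, hΨm, h0, ← pow_two, hω2], ?_⟩
      rw [hκ1, neg_neg, hΨ1, h0]
      exact hω1
  obtain ⟨kG, G, hkG, hGd, hGeq, hG1⟩ := hcont κ
  obtain ⟨kH, H, hkH, hHd, hHeq, hH1⟩ := hcont (-κ)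
  rw [if_pos hΨκ.1] at hkG
  rw [if_neg hΨκ.2] at hkH
  subst hkG
  subst hkH
  exact ⟨1, le_rfl, hmul, ⟨G, hGd, fun s hs => by rw [hGeq s hs, pow_one], hG1⟩,
    ⟨H, hHd, fun s hs => by rw [hHeq s hs, pow_zero, one_mul], hH1⟩⟩

/-- **The named fact reduced to ranks `N ≥ 2`.** `Mok2014_partialAsaiL_continuation_pole_dichotomy`
follows from its own restriction to cuspidal data of rank `N ≥ 2` — the rank-one stratum being the
theorem `Mok2014_partialAsaiL_continuation_pole_dichotomy_rank_one`. (What remains is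
Grbac–Shahidi's Thm. 4.3 (2) proper, `N ≥ 2`: the Langlands–Shahidi theory of the Siegel Eisenstein
series on `U(N, N)` and Mok's classification, and the Rankin–Selberg pole of `L(s, Π × Π^c)`.)
[cite: Mok2014, Thm. 2.5.4 (a)] [cite: GrbacShahidi2015, Thm. 4.3 (2)] -/
theorem Mok2014_partialAsaiL_continuation_pole_dichotomy_of_two_le
    (h : ∀ (F E : Type) [Field F] [NumberField F] [Field E] [NumberField E] [Algebra F E]
      (c : E ≃ₐ[F] E), Module.finrank F E = 2 → c ≠ 1 →
      ∀ (N : ℕ) (hcpt : isCompact_glFiniteIntegralLevel N E)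
        (π : CuspidalAutomorphicRepData N E hcpt), 2 ≤ N → π.1.IsConjSelfDualAE c →
        ∃ η : ℤˣ, ∀ (S : Set (HeightOneSpectrum (𝓞 F))) (A : SatakeFamily E),
          π.1.IsAsaiDatum c S A →
            ∃ σ₀ : ℝ, 1 ≤ σ₀ ∧
              (∀ (θ : ℤˣ) (s : ℂ), σ₀ < s.re →
                Multipliable fun v : {v : HeightOneSpectrum (𝓞 F) // v ∉ S} =>
                  ((asaiLocalPolynomial c A θ (placeAbove E v.1)).eval
                    ((v.1.residueCard : ℂ) ^ (-s)))⁻¹) ∧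
              (∃ G : ℂ → ℂ, DifferentiableOn ℂ G {s : ℂ | 1 / 2 < s.re} ∧
                (∀ s : ℂ, σ₀ < s.re → G s = (s - 1) * partialAsaiL S c A η s) ∧ G 1 ≠ 0) ∧
              (∃ H : ℂ → ℂ, DifferentiableOn ℂ H {s : ℂ | 1 / 2 < s.re} ∧
                (∀ s : ℂ, σ₀ < s.re → H s = partialAsaiL S c A (-η) s) ∧ H 1 ≠ 0)) :
    Mok2014_partialAsaiL_continuation_pole_dichotomy := by
  intro F E _ _ _ _ _ c h2 hc N hcpt π hN hπ
  rcases Nat.lt_or_ge N 2 with hN2 | hN2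
  · obtain rfl : N = 1 := by omega
    exact Mok2014_partialAsaiL_continuation_pole_dichotomy_rank_one F E c h2 hc hcpt π hπ
  · exact h F E c h2 hc N hcpt π hN2 hπ

end RankOne

/-! ### The hypotheses `hHol`, `hRS` of `AsaiSignContProofs` are theorems in rank one; the named fact
is closed modulo their restrictions to ranks `N ≥ 2` -/

section ClosedModulo

variable {F E : Type} [Field F] [NumberField F] [Field E] [NumberField E] [Algebra F E]

/-- **Grbac–Shahidi's holomorphy hypothesis `hHol` of
`Mok2014_partialAsaiL_continuation_pole_dichotomy_of_holomorphy` holds in rank one**: for a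
conjugate self-dual cuspidal datum `π` of `GL₁(𝔸_E)`, every Asai datum `(S, A)` and every sign `η`,
`(s - 1) L^S(s, π, As^η)` continues holomorphically from `{1 < Re s}` to `{1/2 < Re s}` (for the pole
sign the `G` of the rank-one theorem, for the other sign `(s - 1) H`).
[cite: GrbacShahidi2015, Thm. 4.3 (2)(a)] -/
theorem hol_half_plane_rank_one (h2 : Module.finrank F E = 2) {c : E ≃ₐ[F] E} (hc : c ≠ 1)
    {hcpt : isCompact_glFiniteIntegralLevel 1 E} (π : CuspidalAutomorphicRepData 1 E hcpt)
    (hπ : π.1.IsConjSelfDualAE c) {S : Set (HeightOneSpectrum (𝓞 F))} {A : SatakeFamily E}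
    (η : ℤˣ) (hSA : π.1.IsAsaiDatum c S A) :
    ∃ σ₀ : ℝ, 1 ≤ σ₀ ∧ ∃ G : ℂ → ℂ, DifferentiableOn ℂ G {s : ℂ | 1 / 2 < s.re} ∧
      ∀ s : ℂ, σ₀ < s.re → G s = (s - 1) * partialAsaiL S c A η s := by
  obtain ⟨η₀, hη₀⟩ := Mok2014_partialAsaiL_continuation_pole_dichotomy_rank_one F E c h2 hc hcpt π hπ
  obtain ⟨σ₀, hσ₀, -, ⟨G, hG, hGL, -⟩, ⟨H, hH, hHL, -⟩⟩ := hη₀ S A hSA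
  by_cases hη : η = η₀
  · subst hη
    exact ⟨σ₀, hσ₀, G, hG, hGL⟩
  · have hη' : η = -η₀ := Int.units_ne_iff_eq_neg.mp hη
    subst hη'
    exact ⟨σ₀, hσ₀, fun s => (s - 1) * H s, (differentiableOn_id.sub_const 1).mul hH,
      fun s hs => by simp only [hHL s hs]⟩

/-- **The Rankin–Selberg hypothesis `hRS` of `Mok2014_partialAsaiL_continuation_pole_dichotomy_of_holomorphy`
holds in rank one**: for a conjugate self-dual cuspidal datum `π` of `GL₁(𝔸_E)` and an Asai datum
`(S, A)`, the raw pair product `R(s) = L^{S_E}(s, A ⊗ A^c)` is multipliable and holomorphic on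
`{1 < Re s}` and `(s - 1) R(s) → r ≠ 0` as `s → 1⁺`. Indeed `π` acts through a unitary Hecke character
`χ` with `χ (χ ∘ c) = 1` exactly (`HeckeCharacter.normTwist_eq_zero_of_conjSelfDual`), so every factor
of `R` is `(1 - q_w^{-s})⁻¹` (`eval_satakePairPolynomial_rankOne`): `R = ζ_E^{S_E}`, Hecke's
continuation of `ζ_E` with its simple pole (`differentiable_update_sub_one_mul_dedekindZetaCont`,
`tprod_eulerFactor_one_eq_dedekindZetaCont_mul_prod`). This is Mok's "`L(s, φ^N × (φ^N)^c) =
L(s, φ^N × (φ^N)^∨)`, hence has a simple pole at `s = 1`" for `N = 1`.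
[cite: Mok2014, §2.5 (paragraph before Thm. 2.5.4)] [cite: NeukirchANT1999, Ch. VII (5.11)] -/
theorem rankinSelberg_pair_rank_one (h2 : Module.finrank F E = 2) {c : E ≃ₐ[F] E}
    {hcpt : isCompact_glFiniteIntegralLevel 1 E} (π : CuspidalAutomorphicRepData 1 E hcpt)
    (hπ : π.1.IsConjSelfDualAE c) {S : Set (HeightOneSpectrum (𝓞 F))} {A : SatakeFamily E}
    (hSA : π.1.IsAsaiDatum c S A) :
    (∀ s : ℂ, 1 < s.re →
      Multipliable fun w : {w : HeightOneSpectrum (𝓞 E) // w.under (𝓞 F) ∉ S} =>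
        ((satakePairPolynomial (A w.1) (A (c • w.1))).eval ((w.1.residueCard : ℂ) ^ (-s)))⁻¹) ∧
    DifferentiableOn ℂ
      (partialPairL {w : HeightOneSpectrum (𝓞 E) | w.under (𝓞 F) ∈ S} A (fun w => A (c • w)))
      {s : ℂ | 1 < s.re} ∧
    ∃ r : ℂ, r ≠ 0 ∧
      Tendsto (fun s => (s - 1) *
          partialPairL {w : HeightOneSpectrum (𝓞 E) | w.under (𝓞 F) ∈ S} A (fun w => A (c • w)) s)
        (𝓝[{s : ℂ | 1 < s.re}] 1) (𝓝 r) := by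
  haveI hquad : Algebra.IsQuadraticExtension F E := { finrank_eq_two' := h2 }
  /- the Hecke character `χ = χ₀ ‖·‖^{s₁}` of `π`; `χ₀c = χ₀ ∘ c` -/
  obtain ⟨χ, hχπ⟩ := π.1.exists_heckeCharacter_glOne
  obtain ⟨χ₀, ν, s₁, hν, hχ, hχ₀A⟩ := χ.exists_eq_mul_normTwist
  obtain ⟨χ₀c, hχ₀c⟩ := χ₀.exists_galConj c
  have hAχ : ∀ w : HeightOneSpectrum (𝓞 E), w.under (𝓞 F) ∉ S →
      A w = {χ.valueAtUniformizer w} ∧ χ.IsUnramifiedAt w := fun w hw =>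
    ⟨π.1.eq_singleton_valueAtUniformizer_glOne hχπ (hSA.hasSatakeParamAt hw),
      π.1.isUnramifiedAt_heckeCharacter_glOne' hχπ (hSA.hasSatakeParamAt hw)⟩
  have hν' : ∀ x : ideleGroup E, ((ν⁻¹ x : ℂˣ) : ℂ) = ((ideleNorm x : ℝ) : ℂ) ^ (-s₁) :=
    HeckeCharacter.inv_apply_of_forall_apply_eq_cpow hν
  have hχ₀unr : ∀ w : HeightOneSpectrum (𝓞 E), χ.IsUnramifiedAt w → χ₀.IsUnramifiedAt w := by
    intro w hw
    have h0 : χ₀ = χ * ν⁻¹ := by rw [hχ, mul_inv_cancel_right]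
    rw [h0]
    exact hw.mul (HeckeCharacter.IsNormTwist.isUnramifiedAt_holds ⟨-s₁, hν'⟩ w)
  /- conjugate self-duality a.e. ⇒ `s₁ = 0`, `χ₀ (χ₀ ∘ c) = 1` -/
  have hcsd : ∀ᶠ w : HeightOneSpectrum (𝓞 E) in cofinite,
      χ.valueAtUniformizer (c • w) = (χ.valueAtUniformizer w)⁻¹ := by
    have hπ' : ∀ᶠ w : HeightOneSpectrum (𝓞 E) in cofinite, ∀ α β : Multiset ℂ,
        π.1.HasSatakeParamAt w α → π.1.HasSatakeParamAt (c • w) β → β = α.map (·⁻¹) := hπ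
    have hev : ∀ᶠ w : HeightOneSpectrum (𝓞 E) in cofinite, w.under (𝓞 F) ∉ S := by
      rw [Filter.eventually_cofinite]
      simpa using finite_setOf_under_mem hSA.finite
    filter_upwards [hπ', hev] with w hw hwS
    have hcwS : (c • w).under (𝓞 F) ∉ S := by
      rwa [HeightOneSpectrum.under_algEquiv_smul F E c w]
    have h := hw (A w) (A (c • w)) (hSA.hasSatakeParamAt hwS) (hSA.hasSatakeParamAt hcwS)
    rw [(hAχ w hwS).1, (hAχ (c • w) hcwS).1, Multiset.map_singleton, Multiset.singleton_inj] at h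
    exact h
  obtain ⟨hs₁, hΘ⟩ :=
    HeckeCharacter.normTwist_eq_zero_of_conjSelfDual hν hχ hχ₀A hχ₀c hcsd
  subst hs₁
  /- every factor of `R` is `(1 - q_w^{-s})⁻¹`: `R = ζ_E^{S_E}` -/
  set SE : Set (HeightOneSpectrum (𝓞 E)) := {w | w.under (𝓞 F) ∈ S} with hSEdef
  have hSE : SE.Finite := finite_setOf_under_mem hSA.finite
  have hfactor : ∀ (w : HeightOneSpectrum (𝓞 E)), w.under (𝓞 F) ∉ S → ∀ x : ℂ,
      (satakePairPolynomial (A w) (A (c • w))).eval x = 1 - x := by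
    intro w hw x
    have hcw : (c • w).under (𝓞 F) ∉ S := by rwa [HeightOneSpectrum.under_algEquiv_smul F E c w]
    rw [eval_satakePairPolynomial_rankOne (F := F) hν hχ hχ₀c (hAχ w hw).1 (hAχ (c • w) hcw).1
      (hχ₀unr _ (hAχ (c • w) hcw).2), hΘ, valueAtUniformizer_one_contRankOne, mul_zero, neg_zero,
      Complex.cpow_zero, one_mul, one_mul]
  have hReq : ∀ s : ℂ, partialPairL SE A (fun w => A (c • w)) s =
      ∏' w : {w : HeightOneSpectrum (𝓞 E) // w ∉ SE}, (1 - ((w.1.residueCard : ℂ) ^ (-s)))⁻¹ :=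
    fun s => tprod_congr fun w => by rw [hfactor w.1 w.2]
  -- multipliability on `{1 < Re s}`
  have hmulP : ∀ s : ℂ, 1 < s.re →
      Multipliable fun w : {w : HeightOneSpectrum (𝓞 E) // w.under (𝓞 F) ∉ S} =>
        ((satakePairPolynomial (A w.1) (A (c • w.1))).eval ((w.1.residueCard : ℂ) ^ (-s)))⁻¹ := by
    intro s hs
    refine (multipliable_congr fun w => ?_).mpr (multipliable_inv_one_sub_residueCard_cpow_neg SE hs)
    rw [hfactor w.1 w.2]
  -- `R = ζ_E · ∏_{w ∈ S_E} (1 - q_w^{-s})` on `{1 < Re s}`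
  set P : ℂ → ℂ := fun s => ∏ w ∈ hSE.toFinset, (1 - ((w.residueCard : ℂ) ^ (-s))) with hP
  have hPd : Differentiable ℂ P :=
    Differentiable.fun_finsetProd fun w _ => differentiable_one_sub_residueCard_cpow_neg w
  have hRζ : ∀ s : ℂ, 1 < s.re →
      partialPairL SE A (fun w => A (c • w)) s = LFunctions.dedekindZetaCont E s * P s :=
    fun s hs => by rw [hReq s, tprod_eulerFactor_one_eq_dedekindZetaCont_mul_prod hSE hs]
  have hopen : IsOpen {s : ℂ | 1 < s.re} := isOpen_lt continuous_const Complex.continuous_re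
  have hsub : {s : ℂ | 1 < s.re} ⊆ ({1}ᶜ : Set ℂ) := fun s hs h1 => by
    rw [Set.mem_singleton_iff.mp h1, Set.mem_setOf_eq, Complex.one_re] at hs
    exact lt_irrefl _ hs
  refine ⟨hmulP, ?_, ?_⟩
  · -- holomorphy on `{1 < Re s}`
    have hζd : DifferentiableOn ℂ (fun s => LFunctions.dedekindZetaCont E s * P s) {s : ℂ | 1 < s.re} :=
      ((LFunctions.NumberField.isDedekindZetaContinuation_dedekindZetaCont_holds E).differentiableOn.mono
        hsub).mul hPd.differentiableOn
    exact hζd.congr fun s hs => hRζ s hs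
  · -- the simple pole: `(s - 1) R(s) → ρ_E · P(1) ≠ 0`
    set Z : ℂ → ℂ := Function.update (fun s : ℂ => (s - 1) * LFunctions.dedekindZetaCont E s) 1
      ((_root_.NumberField.dedekindZeta_residue E : ℝ) : ℂ) with hZ
    have hZc : ContinuousAt Z 1 := (differentiable_update_sub_one_mul_dedekindZetaCont (K := E) 1).continuousAt
    have hZ1 : Z 1 = ((_root_.NumberField.dedekindZeta_residue E : ℝ) : ℂ) := Function.update_self ..
    have hP1 : P 1 ≠ 0 := Finset.prod_ne_zero_iff.mpr fun w _ =>
      one_sub_residueCard_cpow_neg_ne_zero w (by rw [Complex.one_re]; exact one_pos)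
    refine ⟨Z 1 * P 1, mul_ne_zero (by rw [hZ1]; exact_mod_cast (_root_.NumberField.dedekindZeta_residue_pos E).ne') hP1, ?_⟩
    have hlim : Tendsto (fun s => Z s * P s) (𝓝[{s : ℂ | 1 < s.re}] 1) (𝓝 (Z 1 * P 1)) :=
      ((hZc.mul (hPd 1).continuousAt).tendsto).mono_left nhdsWithin_le_nhds
    refine hlim.congr' ?_
    filter_upwards [self_mem_nhdsWithin] with s hs
    have hs1 : s ≠ 1 := fun h => hsub hs (Set.mem_singleton_iff.mpr h)
    show Z s * P s = (s - 1) * partialPairL SE A (fun w => A (c • w)) s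
    rw [hZ, Function.update_of_ne hs1, hRζ s hs, mul_assoc]

/-- **The named fact is closed modulo its rank `≥ 2` inputs**: `Mok2014_partialAsaiL_continuation_pole_dichotomy`
follows from Grbac–Shahidi's holomorphy hypothesis `hHol` and the Rankin–Selberg hypothesis `hRS` of
`Mok2014_partialAsaiL_continuation_pole_dichotomy_of_holomorphy` (`AsaiSignContProofs`) RESTRICTED TO
RANKS `N ≥ 2` — in rank one both are theorems (`hol_half_plane_rank_one`,
`rankinSelberg_pair_rank_one`). What remains of the fact is thus exactly: the holomorphy on
`{1/2 < Re s}` of `(s - 1) L^S(s, Π, As^±)` for conjugate self-dual cuspidal `Π` on `GL_N(𝔸_E)`,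
`N ≥ 2` (Grbac–Shahidi, Thm. 4.3 (2)(a): Langlands–Shahidi on `U(N, N)` and Mok's classification),
and Jacquet–Shalika's simple pole of `L^{S_E}(s, Π × Π^c)` for such `Π`.
[cite: GrbacShahidi2015, Thm. 4.3 (2) and its proof, pp. 204–206]
[cite: Mok2014, §2.5 (paragraph before Thm. 2.5.4) and Thm. 2.5.4 (a)] -/
theorem Mok2014_partialAsaiL_continuation_pole_dichotomy_of_holomorphy_two_le
    (hHol : ∀ (F E : Type) [Field F] [NumberField F] [Field E] [NumberField E] [Algebra F E]
      (c : E ≃ₐ[F] E), Module.finrank F E = 2 → c ≠ 1 →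
      ∀ (N : ℕ) (hcpt : isCompact_glFiniteIntegralLevel N E)
        (π : CuspidalAutomorphicRepData N E hcpt), 2 ≤ N → π.1.IsConjSelfDualAE c →
        ∀ (S : Set (HeightOneSpectrum (𝓞 F))) (A : SatakeFamily E) (η : ℤˣ),
          π.1.IsAsaiDatum c S A →
          ∃ σ₀ : ℝ, 1 ≤ σ₀ ∧ ∃ G : ℂ → ℂ, DifferentiableOn ℂ G {s : ℂ | 1 / 2 < s.re} ∧
            ∀ s : ℂ, σ₀ < s.re → G s = (s - 1) * partialAsaiL S c A η s)
    (hRS : ∀ (F E : Type) [Field F] [NumberField F] [Field E] [NumberField E] [Algebra F E]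
      (c : E ≃ₐ[F] E), Module.finrank F E = 2 → c ≠ 1 →
      ∀ (N : ℕ) (hcpt : isCompact_glFiniteIntegralLevel N E)
        (π : CuspidalAutomorphicRepData N E hcpt), 2 ≤ N → π.1.IsConjSelfDualAE c →
        ∀ (S : Set (HeightOneSpectrum (𝓞 F))) (A : SatakeFamily E), π.1.IsAsaiDatum c S A →
          (∀ s : ℂ, 1 < s.re →
            Multipliable fun w : {w : HeightOneSpectrum (𝓞 E) // w.under (𝓞 F) ∉ S} =>
              ((satakePairPolynomial (A w.1) (A (c • w.1))).eval
                ((w.1.residueCard : ℂ) ^ (-s)))⁻¹) ∧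
          DifferentiableOn ℂ
            (partialPairL {w : HeightOneSpectrum (𝓞 E) | w.under (𝓞 F) ∈ S} A (fun w => A (c • w)))
            {s : ℂ | 1 < s.re} ∧
          ∃ r : ℂ, r ≠ 0 ∧
            Tendsto (fun s => (s - 1) *
                partialPairL {w : HeightOneSpectrum (𝓞 E) | w.under (𝓞 F) ∈ S} A
                  (fun w => A (c • w)) s)
              (𝓝[{s : ℂ | 1 < s.re}] 1) (𝓝 r)) :
    Mok2014_partialAsaiL_continuation_pole_dichotomy := by
  refine Mok2014_partialAsaiL_continuation_pole_dichotomy_of_holomorphy ?_ ?_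
  · intro F E _ _ _ _ _ c h2 hc N hcpt π hN hπ S A η hSA
    rcases Nat.lt_or_ge N 2 with hN2 | hN2
    · obtain rfl : N = 1 := by omega
      exact hol_half_plane_rank_one h2 hc π hπ η hSA
    · exact hHol F E c h2 hc N hcpt π hN2 hπ S A η hSA
  · intro F E _ _ _ _ _ c h2 hc N hcpt π hN hπ S A hSA
    rcases Nat.lt_or_ge N 2 with hN2 | hN2
    · obtain rfl : N = 1 := by omega
      exact rankinSelberg_pair_rank_one h2 π hπ hSA
    · exact hRS F E c h2 hc N hcpt π hN2 hπ S A hSA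

/-- **The hypothesis `hNV` of `Mok2014_partialAsaiL_continuation_pole_dichotomy_of_holomorphy_of_L2`
(`AsaiSignContProofsL2`) holds in rank one**: for a conjugate self-dual cuspidal datum `π` of
`GL₁(𝔸_E)`, an Asai datum `(S, A)`, a sign `θ` and `v ∉ S`, the unramified Asai factor has no pole at
`s = 1`: `det(1 - As^θ(t_v) q_v^{-1}) = 1 - ε ψ₀(ϖ_v) q_v^{-1} ≠ 0` with `|ε ψ₀(ϖ_v)| ≤ 1`
(`eval_asaiLocalPolynomial_rankOne` after the normalisation `s₁ = 0` forced by conjugate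
self-duality; `ψ₀ = χ₀|_{𝕀_F}` unitary). [cite: Flicker1988, pp. 305–306] -/
theorem eval_asaiLocalPolynomial_at_one_ne_zero_rank_one (h2 : Module.finrank F E = 2)
    {c : E ≃ₐ[F] E} (hc : c ≠ 1) {hcpt : isCompact_glFiniteIntegralLevel 1 E}
    (π : CuspidalAutomorphicRepData 1 E hcpt) (hπ : π.1.IsConjSelfDualAE c)
    {S : Set (HeightOneSpectrum (𝓞 F))} {A : SatakeFamily E} (θ : ℤˣ) (hSA : π.1.IsAsaiDatum c S A)
    {v : HeightOneSpectrum (𝓞 F)} (hv : v ∉ S) :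
    (asaiLocalPolynomial c A θ (placeAbove E v)).eval ((v.residueCard : ℂ) ^ (-(1 : ℂ))) ≠ 0 := by
  haveI hquad : Algebra.IsQuadraticExtension F E := { finrank_eq_two' := h2 }
  /- the Hecke character `χ = χ₀ ‖·‖^{s₁}` of `π`, `ψ₀ = χ₀|_{𝕀_F}`, `χ₀c = χ₀ ∘ c` -/
  obtain ⟨χ, hχπ⟩ := π.1.exists_heckeCharacter_glOne
  obtain ⟨χ₀, ν, s₁, hν, hχ, hχ₀A⟩ := χ.exists_eq_mul_normTwist
  have hχ₀u : χ₀.IsUnitary := HeckeCharacter.isUnitary_of_map_posRealIdele hχ₀A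
  obtain ⟨ψ₀, hψ₀⟩ := χ₀.exists_restrict F
  obtain ⟨χ₀c, hχ₀c⟩ := χ₀.exists_galConj c
  have hψ₀u : ψ₀.IsUnitary := fun x => by rw [hψ₀]; exact hχ₀u _
  have hAχ : ∀ w : HeightOneSpectrum (𝓞 E), w.under (𝓞 F) ∉ S →
      A w = {χ.valueAtUniformizer w} ∧ χ.IsUnramifiedAt w := fun w hw =>
    ⟨π.1.eq_singleton_valueAtUniformizer_glOne hχπ (hSA.hasSatakeParamAt hw),
      π.1.isUnramifiedAt_heckeCharacter_glOne' hχπ (hSA.hasSatakeParamAt hw)⟩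
  have hν' : ∀ x : ideleGroup E, ((ν⁻¹ x : ℂˣ) : ℂ) = ((ideleNorm x : ℝ) : ℂ) ^ (-s₁) :=
    HeckeCharacter.inv_apply_of_forall_apply_eq_cpow hν
  have hχ₀unr : ∀ w : HeightOneSpectrum (𝓞 E), χ.IsUnramifiedAt w → χ₀.IsUnramifiedAt w := by
    intro w hw
    have h0 : χ₀ = χ * ν⁻¹ := by rw [hχ, mul_inv_cancel_right]
    rw [h0]
    exact hw.mul (HeckeCharacter.IsNormTwist.isUnramifiedAt_holds ⟨-s₁, hν'⟩ w)
  /- conjugate self-duality a.e. ⇒ `s₁ = 0` -/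
  have hcsd : ∀ᶠ w : HeightOneSpectrum (𝓞 E) in cofinite,
      χ.valueAtUniformizer (c • w) = (χ.valueAtUniformizer w)⁻¹ := by
    have hπ' : ∀ᶠ w : HeightOneSpectrum (𝓞 E) in cofinite, ∀ α β : Multiset ℂ,
        π.1.HasSatakeParamAt w α → π.1.HasSatakeParamAt (c • w) β → β = α.map (·⁻¹) := hπ
    have hev : ∀ᶠ w : HeightOneSpectrum (𝓞 E) in cofinite, w.under (𝓞 F) ∉ S := by
      rw [Filter.eventually_cofinite]
      simpa using finite_setOf_under_mem hSA.finite
    filter_upwards [hπ', hev] with w hw hwS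
    have hcwS : (c • w).under (𝓞 F) ∉ S := by
      rwa [HeightOneSpectrum.under_algEquiv_smul F E c w]
    have h := hw (A w) (A (c • w)) (hSA.hasSatakeParamAt hwS) (hSA.hasSatakeParamAt hcwS)
    rw [(hAχ w hwS).1, (hAχ (c • w) hcwS).1, Multiset.map_singleton, Multiset.singleton_inj] at h
    exact h
  obtain ⟨hs₁, -⟩ :=
    HeckeCharacter.normTwist_eq_zero_of_conjSelfDual hν hχ hχ₀A hχ₀c hcsd
  subst hs₁
  /- the factor at `v` is `1 - ε ψ₀(ϖ_v) q_v^{-1}`, `|ε| ≤ 1` -/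
  rw [eval_asaiLocalPolynomial_rankOne h2 hc hν hχ hψ₀ (fun w hw => (hAχ w (by rw [hw]; exact hv)).1)
    (fun w hw => hχ₀unr w (hAχ w (by rw [hw]; exact hv)).2)
    (fun w hw hcw => hSA.inertiaDeg_eq_two (by rw [hw]; exact hv) hcw) θ,
    mul_zero, neg_zero, Complex.cpow_zero, mul_one]
  exact one_sub_twistedEulerDatum_ne_zero
    (ε := fun v => if c • placeAbove E v = placeAbove E v then (((θ : ℤ) : ℂ)) else 1) hψ₀u
    (fun v => by
      split_ifs
      · exact norm_intCast_units_le_one θ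
      · simp) v (by rw [Complex.one_re]; exact one_pos)

end ClosedModulo

end Literature.NumberTheory.Automorphic
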